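import Summits.QuantumFields.YangMills.Theorems.BalabanUVNodesN07DentRowsWide
import Summits.QuantumFields.YangMills.Theorems.BalabanUVNodesN07PrintWindowDataSmall
import Summits.QuantumFields.YangMills.Theorems.BalabanUVNodesN07DentPairDataSmall
import HarnessLib

/-!
# N07 [B11] (= [15] = [Balaban1985Variational]) Sect. F — THE CHART's NEAR ROWS AT THE RECORD UNDER THE `Nrm` TEXT OF RECORD `NrmOfRecordWide` (the row ADAPTER, first half):
# print's (160) at TOP CELLS and at DENT PAIRS with every displayed letter of MODULES 62″ ∕ 71″ SUPPLIED FROM THE TOKEN's DATA (MODULES 69b″ ∕ 72) — `δ̂ := (1 + 2C_L)·δ_j`, `a := δ_{j−1}`,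
# so the rows are δ-LINEAR with explicit constants, as HBUDGET-NORM's near letter `β₁` needs (⚑ LOCATED-N1-NEAR-ROWS §1)

Cell `pub-ymgap`, seat `pub-ymgap-dag-n07-e` g25 (FAN-OUT §N07 row s3; LANE OWNER of the K0 road), MODULE 75 (plan g90 RULING A3 (4): «then the ROW ADAPTER (S–M) for HCHART at 60′»).
`--kind proof --supports stmt-QuantumFields-20541 --as helper` (K0⁷); count-neutral; def-free.  [15] = [Balaban1985Variational]; [6] = [Balaban1985RegularSpaces]; [3] = [Balaban1985Averaging];
[III] = [Balaban1988Convergent]; [4] = [Balaban1984PropagatorsII].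

WHAT THIS FILE COMPOSES (by name; nothing new is estimated).  At a MEETING, PRINT-MARGIN-CLEAN datum `(j, idx)` of a separated run `s` of the token (the binders of MODULE 69b: separation, grid
saturation, the knit's floor `(11d + 4ρ + Mc)·L + 3 ≤ ν.M₁`, the ranges `0 < δ_n ≤ a₁`, `δ_n ≤ 2δ_{n+1}`, MODULE 68's `δ_N`-guard, data `W` with (7), `U` on the fibre) and under the
normalisation of record `NrmOfRecordWide … U j idx u A` (MODULE 60′) with the (2.2) collar of print's local family `D″` (`Adm22 D″ R M_b`, `2L ≤ R·M_b + 1`):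
* §1 ★★★ `norm_mlog_shearedAvgIter_top_le_of_data` — EVERY top constraint bond `c` of `D″`: `‖log 𝒜_j(U^u)(c)‖ ≤ 2·(d−1)·crad·(1 + 2C_L)·δ_j`, `crad = ⌊sideP∕2⌋ + 2ρ` — MODULE 62″
  `NrmOfRecordWide.norm_mlog_shearedAvgIter_top_le` with its letter `hV` («(7) for V» on the `□̃` box) supplied by MODULE 69b″ `plaqSmallOn_printWindow_iter_of_data`.
* §2 ★★★ `norm_mlog_shearedAvgIter_dentPair_crossing_le_of_data` — for two chart-box labels `t, t + e_μ` OFF `Γ_j` (a DENT pair) and a level-`(j−1)` constraint bond `b` of `D″` crossing from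
  `B(castSite t)` to `B(castSite (t + e_μ))`: `‖log 𝒜_{j−1}(U^u)(b)‖ ≤ 2·((d−1)·crad·(1+2C_L)·δ_j + 7·t₂(δ_{j−1}) + (d+1)(L−1)·τ_rad(δ_{j−1}))`, `t₂(a) = (((d+2)L)²∕4)·((4(d−1)(2L−1)+1)·a)`,
  `τ_rad(a) = (d(L−1)+1)·((d−1)(L−1)·a)` — MODULE 71″ `NrmOfRecordWide.norm_mlog_shearedAvgIter_dent_crossing_le` with `δ̂` from 69b″ and the two-block letter `a := δ_{j−1}` from MODULE 72
  `plaqSmallOn_dentPair_iter_of_data`; ★★ `norm_mlog_shearedAvgIter_dentPair_within_le_of_data` (both ends in `B(castSite t)`: `≤ 2·τ_rad(δ_{j−1})`).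
The only NEW displayed hypotheses are the two LOG-RANGE guards on `a₁` (`(d−1)·crad·(1+2C_L)·a₁ ≤ ½`, resp. `+ 7t₂(a₁) + (d+1)(L−1)τ_rad(a₁) ≤ ½`) and the non-wrapping of `□̃`
(`tHi ≤ tLo + n`, `n + 1 < N_j`) — kinds the knit already carries.  WHAT IS NOT HERE: the bonds of ⚑ LOCATED-DENT-BOUNDARY (a boundary dent block of `□_j` into an `Ω_j`-block outside `□_j` —
the head's class edition (e3)∕(e4), unruled), the COLLAR far rows (free from 67c's (T2) letters, chart lane), the packaging into HCHART-MEET-NORM-67c's `∃ x_c B B′ A₁` (the (154)–(159) assembly,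
chart lane).

HONEST SCOPE.  Count-neutral by-name composition; `NrmOfRecordWide` (its door CONDITIONAL on `HThm4Rec`, ruling A3), `Adm22`, the token's ∕ run's letters and the guards are HYPOTHESES; nothing
of [15]∕[6]∕[3] ANALYSIS beyond MODULES 68∕70's crude Prop. 1 ∕ Lemma 1; HS3NORM ∕ HCHART-MEET-NORM ∕ HBUDGET-NORM stay displayed in the knit (67c); K0⁷ ∕ K1⁹ NOT closed; N07 NOT discharged and
NOT claimable on road (β); counts unmoved (typed 28∕28 · discharged 7∕28); one finite 𝕋⁴ programme at fixed ε — the route closes the conditional finite-𝕋⁴ rung `BalabanLadder.UV` ONLY; the YM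
mass gap (Clay) is NOT proved by any of this; nothing continuum ∕ ℝ⁴ ∕ OS.  No `sorry`, no `def`, no `instance`, no `notation`.

References: [15] (7) p. 278, (144) p. 300, (147) p. 301, (154) p. 302, (160) p. 303; [6] Lemma 1 (1.25) p. 79, p. 98, (1.129) p. 98; [3] (21) p. 21, Prop. 1 (51) pp. 25–26, (88) p. 31;
[III] (2.2), (2.10)–(2.13) pp. 255–257; [4] (2.1)–(2.3) p. 224.
-/

set_option autoImplicit false

noncomputable section
open scoped BigOperators Matrix.Norms.L2Operator

namespace Summit.QuantumFields.YangMills.BalabanUVNodes.N07NearRowsAtRecordWide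

open Literature.MathematicalPhysics.QuantumFieldTheory.Balaban1983to89
open Literature.MathematicalPhysics.QuantumFieldTheory.Balaban1983to89.Node00
open Literature.MathematicalPhysics.QuantumFieldTheory.Balaban1983to89.B15DeterminingSets
open T4Continuum (T4Family)
open T4AxialGaugeSmallField (castSite boxBonds boxPlaqs)
open B7Prop1Explicit (e e_apply)
open B15Eq112TorusCover (cover)
open B14DomainGeom (Pt Within)
open B8Eq131Cubes (box sqLo sqHi tLo tHi crad)
open GaugeField (gaugeAct)
open ExpMeanLog (expMeanLogSU deltaSU)
open MatrixLog (mlog)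
open Summit.QuantumFields.Balaban3D.Carriers (radialContourData)
open Summit.QuantumFields.YangMills.Theorems.FlatCubeOpsText (Adm22)
open Summit.QuantumFields.YangMills.BalabanUVNodes.N07NormalisationOfRecordWide (NrmOfRecordWide)
open Summit.QuantumFields.YangMills.BalabanUVNodes.N07NormalisationWideRows (NrmOfRecordWide.norm_mlog_shearedAvgIter_top_le Icc_chartBox_subset_Icc_printWindow)
open Summit.QuantumFields.YangMills.BalabanUVNodes.N07DentRowsWide (NrmOfRecordWide.norm_mlog_shearedAvgIter_dent_crossing_le NrmOfRecordWide.norm_mlog_shearedAvgIter_dent_within_le)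
open Summit.QuantumFields.YangMills.BalabanUVNodes.N07PrintWindowDataSmall (plaqSmallOn_printWindow_iter_of_data)
open Summit.QuantumFields.YangMills.BalabanUVNodes.N07ChartTopBoxDataSmall (two_mul_L_lt_sitesPerDir)
open Summit.QuantumFields.YangMills.BalabanUVNodes.N07DentPairDataSmall (plaqSmallOn_dentPair_iter_of_data)
open Summit.QuantumFields.YangMills.BalabanUVNodes.N07DentRowsTwoBlocks (boxPlaqs_mono)

variable (F : T4Family) (N : ℕ) [NeZero N]

/-! ## §1  The top rows at the record -/

/-- ★★★ **THE TOP ROWS AT THE RECORD, EVERY LETTER SUPPLIED** — print's (160), first case, δ-LINEAR with an explicit constant: at a meeting, print-margin-clean datum `(j, idx)` of a separated run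
(MODULE 69b's binders), under `NrmOfRecordWide … u A` and the (2.2) collar of `D″` (`L ≤ ρ`, `1 ≤ ρ`), with `□̃` non-wrapping (`tHi ≤ tLo + n`, `n + 1 < N_j`) and the log-range guard
`(d−1)·crad·((1+2C_L)·a₁) ≤ ½`: EVERY top constraint bond `c` of `D″` carries `‖log 𝒜_j(U^u)(c)‖ ≤ 2·((d−1)·crad·((1 + 2C_L)·δ_j))` (MODULE 62″ ∘ MODULE 69b″).
[cite: Balaban1985Variational, (160) p.303, (147) p.301, (7) p.278; Balaban1985RegularSpaces, p.98, (1.129) p.98; Balaban1985Averaging, (21) p.21, Prop. 1 (51) pp.25–26; Balaban1988Convergent, (2.10)–(2.13) pp.255–257] -/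
theorem norm_mlog_shearedAvgIter_top_le_of_data {ν : Stage7Numerics} {M : ℕ} {g : ℕ → ℝ} {K k : ℕ} (s : SeqOfRecord F ν M g K k)
    (hsep : Sect2.SeqSeparated ν.M₁ s) (hkK : k ≤ (F.P K).m + (F.P K).K)
    (hgrid : ∀ j : ℕ, 1 ≤ j → j ≤ k → dCubeSide (F.P K).L M (RkOfRecord (F.P K).L ν.r (g j)) j ∣ (F.P K).sitesPerDir 0)
    {Mc ρ : ℕ} (hMc : 1 ≤ Mc) (hρ : 1 ≤ ρ) (hLρ : (F.P K).L ≤ ρ) (hfloor : (11 * (F.P K).d + 4 * ρ + Mc) * (F.P K).L + 3 ≤ ν.M₁)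
    {δ : ℕ → ℝ} {a₁ : ℝ} (hδ : ∀ n, n ≤ k → 0 < δ n ∧ δ n ≤ a₁) (hcompδ : ∀ n, n < k → δ n ≤ 2 * δ (n + 1))
    (hguard : (((((F.P K).d + 2) * (F.P K).L : ℕ) : ℝ) ^ 2 / 4) * ((4 * (((((F.P K).d - 1 : ℕ) : ℝ)) * ((2 * (F.P K).L - 1 : ℕ) : ℝ)) + 1) * a₁) < deltaSU (Fin N))
    (hlog : (((F.P K).d - 1 : ℕ) : ℝ) * (crad (sideP (F.P K) Mc ρ) ρ) *
      ((1 + 2 * ((((F.P K).L : ℝ) ^ 2 + 6 * ((((F.P K).d + 2) * (F.P K).L : ℕ) : ℝ) ^ 2) * (4 * (((((F.P K).d - 1 : ℕ) : ℝ)) * ((2 * (F.P K).L - 1 : ℕ) : ℝ)) + 1))) * a₁) ≤ 1 / 2)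
    (W : MSField (F.P K) (SU N)) (h7 : Sect2.DataSmall7PTop (avOfRecord F N K) s.Ω (suppDomOfRecord F ν K s.Ω) k δ W)
    (U : GaugeField (F.P K) 0 (SU N)) (hfib : AgreeOn (genSet s.Ω k) (avgFamily (avOfRecord F N K) U) W)
    {j : ℕ} (hj1 : 1 ≤ j) (hjk : j ≤ k) (hjK : j + 1 ≤ (F.P K).m + (F.P K).K) (idx : Pt (F.P K).d)
    (hmeet : ∃ x ∈ box (F.P K).L (cornerP (F.P K) Mc ρ idx) (sideP (F.P K) Mc ρ) j, ∃ y : Pt (F.P K).d, cover (F.P K) y ∈ s.Ω j ∧ Within ((3 : ℕ) : ℤ) x y)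
    (hclean : j = k ∨ ∀ z ∈ box (F.P K).L (cornerP (F.P K) Mc ρ idx - ((2 * ρ : ℕ) : Pt (F.P K).d)) (sideP (F.P K) Mc ρ + 2 * (2 * ρ)) j, cover (F.P K) z ∉ s.Ω (j + 1))
    {n : ℕ} (hn : ∀ κ, (tHi (cornerP (F.P K) Mc ρ idx) (sideP (F.P K) Mc ρ) ρ) κ ≤ (tLo (cornerP (F.P K) Mc ρ idx) ρ) κ + n) (hnN : n + 1 < (F.P K).sitesPerDir j)
    -- the normalisation of record and the (2.2) collar of `D″`
    {u : GaugeTransf (F.P K) 0 (SU N)} {A : PBond (F.P K) 0 → MatA N} (hk : j ≤ (F.P K).m + (F.P K).K)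
    (hN : NrmOfRecordWide F N Mc ρ ν M g K k s U j idx u A) {R Mb : ℕ}
    (hAdm : Adm22 (domainsMeet (cubeDomains (F.P K) (cornerP (F.P K) Mc ρ idx) (sideP (F.P K) Mc ρ) ρ j hk) (domainsOfSeq s.Ω j hk)) R Mb) (hRM : 2 * (F.P K).L ≤ R * Mb + 1)
    (c : PBond (F.P K) j) (hc : (domainsMeet (cubeDomains (F.P K) (cornerP (F.P K) Mc ρ idx) (sideP (F.P K) Mc ρ) ρ j hk) (domainsOfSeq s.Ω j hk)).LamBond j c) :
    ‖mlog ((shearedAvgIter (avOfRecord F N K) (fun i => radialContourData (F.P K) i (SU N)) (loopAvgBlockOp expMeanLogSU) (gaugeAct u U) j c : SU N) : MatA N)‖ ≤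
      2 * ((((F.P K).d - 1 : ℕ) : ℝ) * (crad (sideP (F.P K) Mc ρ) ρ) *
        ((1 + 2 * ((((F.P K).L : ℝ) ^ 2 + 6 * ((((F.P K).d + 2) * (F.P K).L : ℕ) : ℝ) ^ 2) * (4 * (((((F.P K).d - 1 : ℕ) : ℝ)) * ((2 * (F.P K).L - 1 : ℕ) : ℝ)) + 1))) * δ j)) := by
  -- the letter `δ̂ = (1 + 2C_L)·δ_j` on the `□̃` box from the data (MODULE 69b″)
  have hV := plaqSmallOn_printWindow_iter_of_data F N s hsep hkK hgrid hMc hρ hfloor hδ hcompδ hguard W h7 U hfib hj1 hjk hjK idx hmeet hclean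
  have hδj1 : δ j ≤ a₁ := (hδ j hjk).2
  have h1CL : (0 : ℝ) ≤ 1 + 2 * ((((F.P K).L : ℝ) ^ 2 + 6 * ((((F.P K).d + 2) * (F.P K).L : ℕ) : ℝ) ^ 2) *
      (4 * (((((F.P K).d - 1 : ℕ) : ℝ)) * ((2 * (F.P K).L - 1 : ℕ) : ℝ)) + 1)) := by positivity
  have hX0 : (0 : ℝ) ≤ (((F.P K).d - 1 : ℕ) : ℝ) * (crad (sideP (F.P K) Mc ρ) ρ) := by positivity
  have hδhat : 0 ≤ (1 + 2 * ((((F.P K).L : ℝ) ^ 2 + 6 * ((((F.P K).d + 2) * (F.P K).L : ℕ) : ℝ) ^ 2) *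
      (4 * (((((F.P K).d - 1 : ℕ) : ℝ)) * ((2 * (F.P K).L - 1 : ℕ) : ℝ)) + 1))) * δ j := mul_nonneg h1CL (hδ j hjk).1.le
  -- the log range at the datum from the guard on `a₁`
  have hr := le_trans (mul_le_mul_of_nonneg_left (mul_le_mul_of_nonneg_left hδj1 h1CL) hX0) hlog
  exact NrmOfRecordWide.norm_mlog_shearedAvgIter_top_le hN hk hj1 hρ hLρ hAdm hRM hδhat hV hn hnN hr c hc

/-! ## §2  The dent-pair rows at the record -/

/-- ★★★ **THE DENT-PAIR CROSSING ROWS AT THE RECORD, EVERY LETTER SUPPLIED** — print's (160), second case, δ-LINEAR with explicit constants: at a meeting, print-margin-clean datum `(j, idx)`,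
`j = m + 1`, of a separated run (MODULE 69b's binders), under `NrmOfRecordWide … u A` and the (2.2) collar of `D″` (`1 ≤ ρ`), with `□̃` non-wrapping (`tHi − tLo < N_j`) and ONE log-range guard on
`a₁`: for two chart-box labels `t, t + e_μ` OFF `Γ_j` (a dent pair of the data) and every level-`m` constraint bond `b` of `D″` crossing from `B(castSite t)` to `B(castSite (t + e_μ))`,
`‖log 𝒜_m(U^u)(b)‖ ≤ 2·((d−1)·crad·((1+2C_L)·δ_j) + 7·t₂(δ_m) + (d+1)(L−1)·τ_rad(δ_m))` (MODULE 71″ ∘ MODULES 69b″ ∕ 72).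
[cite: Balaban1985Variational, (160) p.303 (second case), (147) p.301, (7) p.278; Balaban1985RegularSpaces, Lemma 1 (1.25) p.79, p.98, (1.129) p.98; Balaban1985Averaging, (21) p.21, (88) p.31; Balaban1988Convergent, (2.10)–(2.13) pp.255–257] -/
theorem norm_mlog_shearedAvgIter_dentPair_crossing_le_of_data {ν : Stage7Numerics} {M : ℕ} {g : ℕ → ℝ} {K k : ℕ} (s : SeqOfRecord F ν M g K k)
    (hsep : Sect2.SeqSeparated ν.M₁ s) (hkK : k ≤ (F.P K).m + (F.P K).K)
    (hgrid : ∀ j : ℕ, 1 ≤ j → j ≤ k → dCubeSide (F.P K).L M (RkOfRecord (F.P K).L ν.r (g j)) j ∣ (F.P K).sitesPerDir 0)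
    {Mc ρ : ℕ} (hMc : 1 ≤ Mc) (hρ : 1 ≤ ρ) (hfloor : (11 * (F.P K).d + 4 * ρ + Mc) * (F.P K).L + 3 ≤ ν.M₁)
    {δ : ℕ → ℝ} {a₁ : ℝ} (hδ : ∀ n, n ≤ k → 0 < δ n ∧ δ n ≤ a₁) (hcompδ : ∀ n, n < k → δ n ≤ 2 * δ (n + 1))
    (hguard : (((((F.P K).d + 2) * (F.P K).L : ℕ) : ℝ) ^ 2 / 4) * ((4 * (((((F.P K).d - 1 : ℕ) : ℝ)) * ((2 * (F.P K).L - 1 : ℕ) : ℝ)) + 1) * a₁) < deltaSU (Fin N))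
    (hlog : (((F.P K).d - 1 : ℕ) : ℝ) * (crad (sideP (F.P K) Mc ρ) ρ) *
        ((1 + 2 * ((((F.P K).L : ℝ) ^ 2 + 6 * ((((F.P K).d + 2) * (F.P K).L : ℕ) : ℝ) ^ 2) * (4 * (((((F.P K).d - 1 : ℕ) : ℝ)) * ((2 * (F.P K).L - 1 : ℕ) : ℝ)) + 1))) * a₁) +
      7 * ((((((F.P K).d + 2) * (F.P K).L : ℕ) : ℝ) ^ 2 / 4) * ((4 * (((((F.P K).d - 1 : ℕ) : ℝ)) * ((2 * (F.P K).L - 1 : ℕ) : ℝ)) + 1) * a₁)) +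
      ((((F.P K).d + 1) * ((F.P K).L - 1) : ℕ) : ℝ) *
        ((((F.P K).d * ((F.P K).L - 1) + 1 : ℕ) : ℝ) * (((((F.P K).d - 1 : ℕ) : ℝ) * (((F.P K).L - 1 : ℕ) : ℝ)) * a₁)) ≤ 1 / 2)
    (W : MSField (F.P K) (SU N)) (h7 : Sect2.DataSmall7PTop (avOfRecord F N K) s.Ω (suppDomOfRecord F ν K s.Ω) k δ W)
    (U : GaugeField (F.P K) 0 (SU N)) (hfib : AgreeOn (genSet s.Ω k) (avgFamily (avOfRecord F N K) U) W)
    {m : ℕ} (hjk : m + 1 ≤ k) (hjK : m + 1 + 1 ≤ (F.P K).m + (F.P K).K) (idx : Pt (F.P K).d)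
    (hmeet : ∃ x ∈ box (F.P K).L (cornerP (F.P K) Mc ρ idx) (sideP (F.P K) Mc ρ) (m + 1), ∃ y : Pt (F.P K).d, cover (F.P K) y ∈ s.Ω (m + 1) ∧ Within ((3 : ℕ) : ℤ) x y)
    (hclean : m + 1 = k ∨ ∀ z ∈ box (F.P K).L (cornerP (F.P K) Mc ρ idx - ((2 * ρ : ℕ) : Pt (F.P K).d)) (sideP (F.P K) Mc ρ + 2 * (2 * ρ)) (m + 1),
      cover (F.P K) z ∉ s.Ω (m + 1 + 1))
    (hnN : ∀ κ, (tHi (cornerP (F.P K) Mc ρ idx) (sideP (F.P K) Mc ρ) ρ) κ - (tLo (cornerP (F.P K) Mc ρ idx) ρ) κ < (F.P K).sitesPerDir (m + 1))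
    -- the dent pair of the chart's top box
    (t : Pt (F.P K).d) (μ : Fin (F.P K).d)
    (ht : t ∈ Set.Icc (sqLo (F.P K).L (cornerP (F.P K) Mc ρ idx) ρ (m + 1) (m + 1) - 1) (sqHi (F.P K).L (cornerP (F.P K) Mc ρ idx) (sideP (F.P K) Mc ρ) ρ (m + 1) (m + 1) + 1))
    (htμ : t + e μ ∈ Set.Icc (sqLo (F.P K).L (cornerP (F.P K) Mc ρ idx) ρ (m + 1) (m + 1) - 1) (sqHi (F.P K).L (cornerP (F.P K) Mc ρ idx) (sideP (F.P K) Mc ρ) ρ (m + 1) (m + 1) + 1))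
    (hdent : (castSite t : Site (F.P K) (m + 1)) ∉ genSet s.Ω k (m + 1)) (hdentμ : (castSite (t + e μ) : Site (F.P K) (m + 1)) ∉ genSet s.Ω k (m + 1))
    -- the normalisation of record and the (2.2) collar of `D″`
    {u : GaugeTransf (F.P K) 0 (SU N)} {A : PBond (F.P K) 0 → MatA N} (hk : m + 1 ≤ (F.P K).m + (F.P K).K)
    (hN : NrmOfRecordWide F N Mc ρ ν M g K k s U (m + 1) idx u A) {R Mb : ℕ}
    (hAdm : Adm22 (domainsMeet (cubeDomains (F.P K) (cornerP (F.P K) Mc ρ idx) (sideP (F.P K) Mc ρ) ρ (m + 1) hk) (domainsOfSeq s.Ω (m + 1) hk)) R Mb)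
    (hRM : 2 * (F.P K).L ≤ R * Mb + 1)
    -- the bond: a `D″`-constraint bond of level `m` crossing from `B(castSite t)` to `B(castSite (t + e_μ))`
    (b : PBond (F.P K) m)
    (hb : (domainsMeet (cubeDomains (F.P K) (cornerP (F.P K) Mc ρ idx) (sideP (F.P K) Mc ρ) ρ (m + 1) hk) (domainsOfSeq s.Ω (m + 1) hk)).LamBond m b)
    (hsrc : blockOf b.src = (castSite t : Site (F.P K) (m + 1))) (hdir : b.dir = μ) (htgt : blockOf b.tgt = (castSite (t + e μ) : Site (F.P K) (m + 1))) :
    ‖mlog ((shearedAvgIter (avOfRecord F N K) (fun i => radialContourData (F.P K) i (SU N)) (loopAvgBlockOp expMeanLogSU) (gaugeAct u U) m b : SU N) : MatA N)‖ ≤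
      2 * ((((F.P K).d - 1 : ℕ) : ℝ) * (crad (sideP (F.P K) Mc ρ) ρ : ℕ) *
          ((1 + 2 * ((((F.P K).L : ℝ) ^ 2 + 6 * ((((F.P K).d + 2) * (F.P K).L : ℕ) : ℝ) ^ 2) * (4 * (((((F.P K).d - 1 : ℕ) : ℝ)) * ((2 * (F.P K).L - 1 : ℕ) : ℝ)) + 1))) * δ (m + 1)) +
        7 * ((((((F.P K).d + 2) * (F.P K).L : ℕ) : ℝ) ^ 2 / 4) * ((4 * (((((F.P K).d - 1 : ℕ) : ℝ)) * ((2 * (F.P K).L - 1 : ℕ) : ℝ)) + 1) * δ m)) +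
        ((((F.P K).d + 1) * ((F.P K).L - 1) : ℕ) : ℝ) *
          ((((F.P K).d * ((F.P K).L - 1) + 1 : ℕ) : ℝ) * (((((F.P K).d - 1 : ℕ) : ℝ) * (((F.P K).L - 1 : ℕ) : ℝ)) * δ m))) := by
  -- the two letters from the data: `δ̂` on `□̃` (69b″) and `a := δ_m` on the dent pair (72)
  have hV := plaqSmallOn_printWindow_iter_of_data F N s hsep hkK hgrid hMc hρ hfloor hδ hcompδ hguard W h7 U hfib (by omega : 1 ≤ m + 1) hjk hjK idx hmeet hclean
  have hA := plaqSmallOn_dentPair_iter_of_data F N s hsep hkK hgrid hMc hρ hfloor W h7 U hfib hjk (by omega) idx hmeet hclean t μ ht htμ hdent hdentμ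
  have hδj1 : δ (m + 1) ≤ a₁ := (hδ (m + 1) hjk).2
  have hδm : 0 < δ m := (hδ m (by omega)).1
  have hδm1 : δ m ≤ a₁ := (hδ m (by omega)).2
  -- abbreviations for the three δ-free coefficients (all non-negative)
  have hCL0 : (0 : ℝ) ≤ 1 + 2 * ((((F.P K).L : ℝ) ^ 2 + 6 * ((((F.P K).d + 2) * (F.P K).L : ℕ) : ℝ) ^ 2) *
      (4 * (((((F.P K).d - 1 : ℕ) : ℝ)) * ((2 * (F.P K).L - 1 : ℕ) : ℝ)) + 1)) := by positivity
  have hX0 : (0 : ℝ) ≤ (((F.P K).d - 1 : ℕ) : ℝ) * (crad (sideP (F.P K) Mc ρ) ρ : ℕ) := by positivity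
  have hTa0 : (0 : ℝ) ≤ ((((F.P K).d + 1) * ((F.P K).L - 1) : ℕ) : ℝ) := by positivity
  have hTb0 : (0 : ℝ) ≤ (((F.P K).d * ((F.P K).L - 1) + 1 : ℕ) : ℝ) := by positivity
  have hTc0 : (0 : ℝ) ≤ ((((F.P K).d - 1 : ℕ) : ℝ) * (((F.P K).L - 1 : ℕ) : ℝ)) := by positivity
  have hδhat : 0 ≤ (1 + 2 * ((((F.P K).L : ℝ) ^ 2 + 6 * ((((F.P K).d + 2) * (F.P K).L : ℕ) : ℝ) ^ 2) *
      (4 * (((((F.P K).d - 1 : ℕ) : ℝ)) * ((2 * (F.P K).L - 1 : ℕ) : ℝ)) + 1))) * δ (m + 1) := mul_nonneg hCL0 (hδ (m + 1) hjk).1.le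
  -- the guards at the datum's letters from the guards on `a₁` (monotonicity only)
  have ht2 : (((((F.P K).d + 2) * (F.P K).L : ℕ) : ℝ) ^ 2 / 4) * ((4 * (((((F.P K).d - 1 : ℕ) : ℝ)) * ((2 * (F.P K).L - 1 : ℕ) : ℝ)) + 1) * δ m) < deltaSU (Fin N) := by
    refine lt_of_le_of_lt ?_ hguard
    gcongr
  have hNm : 2 * (F.P K).L < (F.P K).sitesPerDir m := two_mul_L_lt_sitesPerDir (by omega)
  have h1 := mul_le_mul_of_nonneg_left (mul_le_mul_of_nonneg_left hδj1 hCL0) hX0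
  have hA0 : (0 : ℝ) ≤ ((((F.P K).d + 2) * (F.P K).L : ℕ) : ℝ) ^ 2 / 4 := by positivity
  have hB0 : (0 : ℝ) ≤ 4 * (((((F.P K).d - 1 : ℕ) : ℝ)) * ((2 * (F.P K).L - 1 : ℕ) : ℝ)) + 1 := by positivity
  have h2 : 7 * ((((((F.P K).d + 2) * (F.P K).L : ℕ) : ℝ) ^ 2 / 4) * ((4 * (((((F.P K).d - 1 : ℕ) : ℝ)) * ((2 * (F.P K).L - 1 : ℕ) : ℝ)) + 1) * δ m)) ≤
      7 * ((((((F.P K).d + 2) * (F.P K).L : ℕ) : ℝ) ^ 2 / 4) * ((4 * (((((F.P K).d - 1 : ℕ) : ℝ)) * ((2 * (F.P K).L - 1 : ℕ) : ℝ)) + 1) * a₁)) :=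
    mul_le_mul_of_nonneg_left (mul_le_mul_of_nonneg_left (mul_le_mul_of_nonneg_left hδm1 hB0) hA0) (by norm_num)
  have h3 := mul_le_mul_of_nonneg_left (mul_le_mul_of_nonneg_left (mul_le_mul_of_nonneg_left hδm1 hTc0) hTb0) hTa0
  have hr : (((F.P K).d - 1 : ℕ) : ℝ) * (crad (sideP (F.P K) Mc ρ) ρ : ℕ) *
        ((1 + 2 * ((((F.P K).L : ℝ) ^ 2 + 6 * ((((F.P K).d + 2) * (F.P K).L : ℕ) : ℝ) ^ 2) *
          (4 * (((((F.P K).d - 1 : ℕ) : ℝ)) * ((2 * (F.P K).L - 1 : ℕ) : ℝ)) + 1))) * δ (m + 1)) +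
        7 * ((((((F.P K).d + 2) * (F.P K).L : ℕ) : ℝ) ^ 2 / 4) * ((4 * (((((F.P K).d - 1 : ℕ) : ℝ)) * ((2 * (F.P K).L - 1 : ℕ) : ℝ)) + 1) * δ m)) +
        ((((F.P K).d + 1) * ((F.P K).L - 1) : ℕ) : ℝ) *
          ((((F.P K).d * ((F.P K).L - 1) + 1 : ℕ) : ℝ) * (((((F.P K).d - 1 : ℕ) : ℝ) * (((F.P K).L - 1 : ℕ) : ℝ)) * δ m)) ≤ 1 / 2 := by
    linarith [h1, h2, h3, hlog]
  -- the parent `⟨castSite t, μ⟩` is a box bond of `□̃` (chart box ⊆ `□̃`, MODULE 62″ §1)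
  have hIcc := Icc_chartBox_subset_Icc_printWindow (F.P K).L (cornerP (F.P K) Mc ρ idx) (sideP (F.P K) Mc ρ) hρ (m + 1)
  have hpar : (⟨castSite t, μ⟩ : PBond (F.P K) (m + 1)) ∈
      boxBonds (tLo (cornerP (F.P K) Mc ρ idx) ρ) (tHi (cornerP (F.P K) Mc ρ idx) (sideP (F.P K) Mc ρ) ρ) :=
    ⟨t, (hIcc ht).1, (hIcc htμ).2, rfl⟩
  exact NrmOfRecordWide.norm_mlog_shearedAvgIter_dent_crossing_le F N hN hk hAdm hRM hρ hδhat hV hnN t μ hpar hδm hNm ht2 hA hr b hb hsrc hdir htgt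

/-- ★★ **THE DENT-PAIR WITHIN-BLOCK ROWS AT THE RECORD, EVERY LETTER SUPPLIED**: the same datum and dent pair; for a level-`m` constraint bond `b` of `D″` with BOTH ends in `B(castSite t)`,
`‖log 𝒜_m(U^u)(b)‖ ≤ 2·τ_rad(δ_m)` (MODULE 71″'s within row with the two-block letter of MODULE 72 restricted to the block; guard `τ_rad(a₁) ≤ ½`).
[cite: Balaban1985Variational, (160) p.303; Balaban1985RegularSpaces, (1.15) p.78, pp.79–80; Balaban1988Convergent, (2.10)–(2.13) pp.255–257] -/
theorem norm_mlog_shearedAvgIter_dentPair_within_le_of_data {ν : Stage7Numerics} {M : ℕ} {g : ℕ → ℝ} {K k : ℕ} (s : SeqOfRecord F ν M g K k)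
    (hsep : Sect2.SeqSeparated ν.M₁ s) (hkK : k ≤ (F.P K).m + (F.P K).K)
    (hgrid : ∀ j : ℕ, 1 ≤ j → j ≤ k → dCubeSide (F.P K).L M (RkOfRecord (F.P K).L ν.r (g j)) j ∣ (F.P K).sitesPerDir 0)
    {Mc ρ : ℕ} (hMc : 1 ≤ Mc) (hρ : 1 ≤ ρ) (hfloor : (11 * (F.P K).d + 4 * ρ + Mc) * (F.P K).L + 3 ≤ ν.M₁)
    {δ : ℕ → ℝ} {a₁ : ℝ} (hδ : ∀ n, n ≤ k → 0 < δ n ∧ δ n ≤ a₁)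
    (hlog : (((F.P K).d * ((F.P K).L - 1) + 1 : ℕ) : ℝ) * (((((F.P K).d - 1 : ℕ) : ℝ) * (((F.P K).L - 1 : ℕ) : ℝ)) * a₁) ≤ 1 / 2)
    (W : MSField (F.P K) (SU N)) (h7 : Sect2.DataSmall7PTop (avOfRecord F N K) s.Ω (suppDomOfRecord F ν K s.Ω) k δ W)
    (U : GaugeField (F.P K) 0 (SU N)) (hfib : AgreeOn (genSet s.Ω k) (avgFamily (avOfRecord F N K) U) W)
    {m : ℕ} (hjk : m + 1 ≤ k) (hjK : m + 1 + 1 ≤ (F.P K).m + (F.P K).K) (idx : Pt (F.P K).d)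
    (hmeet : ∃ x ∈ box (F.P K).L (cornerP (F.P K) Mc ρ idx) (sideP (F.P K) Mc ρ) (m + 1), ∃ y : Pt (F.P K).d, cover (F.P K) y ∈ s.Ω (m + 1) ∧ Within ((3 : ℕ) : ℤ) x y)
    (hclean : m + 1 = k ∨ ∀ z ∈ box (F.P K).L (cornerP (F.P K) Mc ρ idx - ((2 * ρ : ℕ) : Pt (F.P K).d)) (sideP (F.P K) Mc ρ + 2 * (2 * ρ)) (m + 1),
      cover (F.P K) z ∉ s.Ω (m + 1 + 1))
    (t : Pt (F.P K).d) (μ : Fin (F.P K).d)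
    (ht : t ∈ Set.Icc (sqLo (F.P K).L (cornerP (F.P K) Mc ρ idx) ρ (m + 1) (m + 1) - 1) (sqHi (F.P K).L (cornerP (F.P K) Mc ρ idx) (sideP (F.P K) Mc ρ) ρ (m + 1) (m + 1) + 1))
    (htμ : t + e μ ∈ Set.Icc (sqLo (F.P K).L (cornerP (F.P K) Mc ρ idx) ρ (m + 1) (m + 1) - 1) (sqHi (F.P K).L (cornerP (F.P K) Mc ρ idx) (sideP (F.P K) Mc ρ) ρ (m + 1) (m + 1) + 1))
    (hdent : (castSite t : Site (F.P K) (m + 1)) ∉ genSet s.Ω k (m + 1)) (hdentμ : (castSite (t + e μ) : Site (F.P K) (m + 1)) ∉ genSet s.Ω k (m + 1))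
    {u : GaugeTransf (F.P K) 0 (SU N)} {A : PBond (F.P K) 0 → MatA N} (hk : m + 1 ≤ (F.P K).m + (F.P K).K)
    (hN : NrmOfRecordWide F N Mc ρ ν M g K k s U (m + 1) idx u A) {R Mb : ℕ}
    (hAdm : Adm22 (domainsMeet (cubeDomains (F.P K) (cornerP (F.P K) Mc ρ idx) (sideP (F.P K) Mc ρ) ρ (m + 1) hk) (domainsOfSeq s.Ω (m + 1) hk)) R Mb)
    (hRM : 2 * (F.P K).L ≤ R * Mb + 1)
    (b : PBond (F.P K) m)
    (hb : (domainsMeet (cubeDomains (F.P K) (cornerP (F.P K) Mc ρ idx) (sideP (F.P K) Mc ρ) ρ (m + 1) hk) (domainsOfSeq s.Ω (m + 1) hk)).LamBond m b)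
    (hsrc : blockOf b.src = (castSite t : Site (F.P K) (m + 1))) (htgt : blockOf b.tgt = (castSite t : Site (F.P K) (m + 1))) :
    ‖mlog ((shearedAvgIter (avOfRecord F N K) (fun i => radialContourData (F.P K) i (SU N)) (loopAvgBlockOp expMeanLogSU) (gaugeAct u U) m b : SU N) : MatA N)‖ ≤
      2 * ((((F.P K).d * ((F.P K).L - 1) + 1 : ℕ) : ℝ) * (((((F.P K).d - 1 : ℕ) : ℝ) * (((F.P K).L - 1 : ℕ) : ℝ)) * δ m)) := by
  have hA := plaqSmallOn_dentPair_iter_of_data F N s hsep hkK hgrid hMc hρ hfloor W h7 U hfib hjk (by omega) idx hmeet hclean t μ ht htμ hdent hdentμ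
  have hδm : 0 < δ m := (hδ m (by omega)).1
  have hδm1 : δ m ≤ a₁ := (hδ m (by omega)).2
  have he0 : ∀ κ, (0 : ℤ) ≤ e μ κ := fun κ => by rw [e_apply]; split_ifs <;> norm_num
  have hL0 : (0 : ℤ) ≤ (F.P K).L := by positivity
  -- the one-block box lies in the two-block box
  have hA' : PlaqSmallOn (boxPlaqs (fun i => ((F.P K).L : ℤ) * t i) (fun i => ((F.P K).L : ℤ) * t i + (((F.P K).L : ℤ) - 1))) (δ m)
      (Averaging.iter (avOfRecord F N K) m U) :=
    fun q hq => hA q (boxPlaqs_mono le_rfl (fun i => by simp only [Pi.add_apply]; nlinarith [he0 i]) hq)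
  have hNm : (F.P K).L < (F.P K).sitesPerDir m := by have := two_mul_L_lt_sitesPerDir (P := F.P K) (m := m) (by omega); omega
  have hTc0 : (0 : ℝ) ≤ ((((F.P K).d - 1 : ℕ) : ℝ) * (((F.P K).L - 1 : ℕ) : ℝ)) := by positivity
  have hTb0 : (0 : ℝ) ≤ (((F.P K).d * ((F.P K).L - 1) + 1 : ℕ) : ℝ) := by positivity
  have hr : (((F.P K).d * ((F.P K).L - 1) + 1 : ℕ) : ℝ) * (((((F.P K).d - 1 : ℕ) : ℝ) * (((F.P K).L - 1 : ℕ) : ℝ)) * δ m) ≤ 1 / 2 :=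
    le_trans (mul_le_mul_of_nonneg_left (mul_le_mul_of_nonneg_left hδm1 hTc0) hTb0) hlog
  exact NrmOfRecordWide.norm_mlog_shearedAvgIter_dent_within_le F N hN hk hAdm hRM t hδm.le hNm hA' hr b hb hsrc htgt

end Summit.QuantumFields.YangMills.BalabanUVNodes.N07NearRowsAtRecordWide

end
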